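import Summits.HubbardSuperconductivity.HubbardSuperconductivity.Theorems.AnisotropyChordTransferBlockMinima

/-!
# Route `AnisotropyChord` / H0 rotor rung, route (1): THEOREM L1 and the strict / unique THEOREM Z⁺ — THE TWO-BLOCK CORE
# (abstract form of THEOREM-L1.md (B)–(F), theory seat `hubbard-h0-rotor-theory-1` g12, memo ROTOR-THEORY-12 §178)

Rotated-frame setting (as in `…TransferFlipPinning`): a stoquastic spin-½ matrix `H` (real symmetric, non-positive off the
diagonal, parity preserving, non-zero on the edge double flips of a connected graph), a Hermitian `Y` commuting with `H` that CHANGES the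
parity (the magnetisation `Sʸ_tot` of the rotated frame), an operator `X` acting by `(Xv)(τ) = ½ Σ_x v(τ^{(x)})` (the rotated `Sˣ_tot`: entrywise
NON-NEGATIVE, parity changing), the ground energy `E₀` (a lower bound of the quadratic form) and an even-supported ground vector `P` with
`Y P = 0` and `Y²(XP) = XP` (in the model: the rotated image of the sector-`0` Perron amplitude; `Sʸ_tot` maps `𝓗_0` into `𝓗_{±1}`).

* `oddBlock_perron_Ysq` (THEOREM-L1.md (C)+(F)): the odd block's Perron vector `P_o` (at the odd-block minimum `E_o`) satisfies `Y²P_o = P_o` —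
  `Y²P_o = μP_o` by simplicity, and the POSITIVE PAIRING with `Φ = XP > 0` (a `Y² = 1` vector) forces `μ = 1`;
* `ground_unique_of_twoBlock` (Z⁺ uniqueness): every ground vector of `H` is a multiple of `P` (an odd ground component would make the odd
  block attain `E₀`; then `Y P_o` is an even ground vector, `∝ P`, killed by `Y`, contradicting `Y²P_o = P_o`);
* `energy_bounds_of_twoBlock` (Z⁺ strict + L1): an eigenvector `ψ` (`Hψ = Eψ`, `Yψ = μψ`, `μ ≠ 0`) with both parity components non-zero has
  `E₀ < E` and `E_o ≤ E`, and `E_o < E` unless `μ² = 1`;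
* `exists_oddGround_Y_eq` (THEOREM-L1.md (F), last step): `E_o` is attained by an eigenvector `p` with `Yp = ±p`.

All folklore linear algebra around Perron–Frobenius; the torus instantiation is in `…TransferLevelOne`.  Prover seat `hubbard-h0-rotor-p1` g14.
-/

set_option linter.dupNamespace false
set_option autoImplicit false

noncomputable section

open Finset Matrix
open scoped ComplexOrder
open Literature.MathematicalPhysics.QuantumLattice

namespace Summit.HubbardSuperconductivity.HubbardSuperconductivity.Theorems.AnisotropyChord.Transfer

section TwoBlock

variable {Λ : Type*} [Fintype Λ] [DecidableEq Λ] (G : SimpleGraph Λ)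

/-! ### small lemmas -/

/-- Hermitian operators move across the inner product. [folklore] -/
theorem star_dotProduct_mulVec_of_isHermitian {Y : Op Λ 2} (hY : Yᴴ = Y) (v w : TensorIndex Λ 2 → ℂ) :
    star v ⬝ᵥ Y *ᵥ w = star (Y *ᵥ v) ⬝ᵥ w := by
  rw [Matrix.star_mulVec, hY, ← Matrix.dotProduct_mulVec]

/-- a parity-changing `Y` maps vectors supported in the class `r` to vectors supported in the class `1 − r`. [folklore] -/
theorem mulVec_support_of_parityChanging (Y : Op Λ 2)
    (hYpar : ∀ σ τ : TensorIndex Λ 2, (∑ z, (σ z : ℕ)) % 2 = (∑ z, (τ z : ℕ)) % 2 → Y σ τ = 0) (r : ℕ) (hr : r < 2)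
    {w : TensorIndex Λ 2 → ℂ} (hw : ∀ σ, (∑ z, (σ z : ℕ)) % 2 ≠ r → w σ = 0) :
    ∀ σ : TensorIndex Λ 2, (∑ z, (σ z : ℕ)) % 2 ≠ 1 - r → (Y *ᵥ w) σ = 0 := by
  intro σ hσ'
  have hσ : (∑ z, (σ z : ℕ)) % 2 = r := by have := Nat.mod_lt (∑ z, (σ z : ℕ)) two_pos; omega
  rw [Matrix.mulVec, dotProduct]
  refine Finset.sum_eq_zero fun τ _ => ?_
  by_cases hτ : (∑ z, (τ z : ℕ)) % 2 = r
  · rw [hYpar σ τ (by rw [hσ, hτ]), zero_mul]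
  · rw [hw τ hτ, mul_zero]

/-- `Y²` of a parity-changing `Y` preserves the parity. [folklore] -/
theorem mul_self_apply_of_parityChanging (Y : Op Λ 2)
    (hYpar : ∀ σ τ : TensorIndex Λ 2, (∑ z, (σ z : ℕ)) % 2 = (∑ z, (τ z : ℕ)) % 2 → Y σ τ = 0)
    (σ τ : TensorIndex Λ 2) (h : (∑ z, (σ z : ℕ)) % 2 ≠ (∑ z, (τ z : ℕ)) % 2) : (Y * Y) σ τ = 0 := by
  rw [Matrix.mul_apply]
  refine Finset.sum_eq_zero fun ρ _ => ?_
  by_cases hρ : (∑ z, (ρ z : ℕ)) % 2 = (∑ z, (σ z : ℕ)) % 2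
  · rw [hYpar σ ρ hρ.symm, zero_mul]
  · have : (∑ z, (ρ z : ℕ)) % 2 = (∑ z, (τ z : ℕ)) % 2 := by
      have h1 := Nat.mod_lt (∑ z, (ρ z : ℕ)) two_pos
      have h2 := Nat.mod_lt (∑ z, (σ z : ℕ)) two_pos
      have h3 := Nat.mod_lt (∑ z, (τ z : ℕ)) two_pos
      omega
    rw [hYpar ρ τ this, mul_zero]

/-! ### the odd block's Perron vector is a `Y² = 1` vector -/

/-- **The odd block and the positive pairing (THEOREM-L1.md (C), (F)).**  In the two-block setting of the module docstring: the odd-block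
minimum `E_o` is attained by a vector `P_o`, real and strictly positive on the odd class, with `H P_o = E_o P_o` and `Y(Y P_o) = P_o`;
moreover `E_o` bounds the quadratic form on the odd class and odd-supported eigenvectors at `E_o` are multiples of `P_o`. [folklore] -/
theorem oddBlock_perron_Ysq (hG : G.Connected) (x₀ : Λ) (H Y X : Op Λ 2)
    (hHh : H.IsHermitian)
    (hreal : ∀ σ τ : TensorIndex Λ 2, star (H σ τ) = H σ τ)
    (hsymm : ∀ σ τ : TensorIndex Λ 2, H σ τ = H τ σ)
    (hoff : ∀ σ τ : TensorIndex Λ 2, σ ≠ τ → (H σ τ).re ≤ 0)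
    (hpar : ∀ σ τ : TensorIndex Λ 2, (∑ z, (σ z : ℕ)) % 2 ≠ (∑ z, (τ z : ℕ)) % 2 → H σ τ = 0)
    (hflip : ∀ (x y : Λ) (σ : TensorIndex Λ 2), G.Adj x y → H σ (flipAt x (flipAt y σ)) ≠ 0)
    (hHY : H * Y = Y * H) (hYh : Yᴴ = Y)
    (hYpar : ∀ σ τ : TensorIndex Λ 2, (∑ z, (σ z : ℕ)) % 2 = (∑ z, (τ z : ℕ)) % 2 → Y σ τ = 0)
    (hX : ∀ (v : TensorIndex Λ 2 → ℂ) (τ : TensorIndex Λ 2), (X *ᵥ v) τ = (∑ x, v (flipAt x τ)) / 2)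
    {E₀ : ℝ} (hE0 : ∀ v : TensorIndex Λ 2 → ℂ, E₀ * (star v ⬝ᵥ v).re ≤ (star v ⬝ᵥ H *ᵥ v).re)
    {P : TensorIndex Λ 2 → ℂ} (hP0 : P ≠ 0) (hPsupp : ∀ σ, (∑ z, (σ z : ℕ)) % 2 ≠ 0 → P σ = 0)
    (hHP : H *ᵥ P = (E₀ : ℂ) • P) (hYYX : Y *ᵥ (Y *ᵥ (X *ᵥ P)) = X *ᵥ P) :
    ∃ Po : TensorIndex Λ 2 → ℂ, Po ≠ 0 ∧ (∀ σ, (∑ z, (σ z : ℕ)) % 2 ≠ 1 → Po σ = 0) ∧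
      (∀ σ, (∑ z, (σ z : ℕ)) % 2 = 1 → 0 < (Po σ).re ∧ (Po σ).im = 0) ∧
      H *ᵥ Po = ((H.minEnergyOn (paritySubmodule (Λ := Λ) 1) : ℝ) : ℂ) • Po ∧
      Y *ᵥ (Y *ᵥ Po) = Po ∧
      (∀ v : TensorIndex Λ 2 → ℂ, (∀ σ, (∑ z, (σ z : ℕ)) % 2 ≠ 1 → v σ = 0) →
        H.minEnergyOn (paritySubmodule (Λ := Λ) 1) * (star v ⬝ᵥ v).re ≤ (star v ⬝ᵥ H *ᵥ v).re) ∧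
      (∀ w : TensorIndex Λ 2 → ℂ, (∀ σ, (∑ z, (σ z : ℕ)) % 2 ≠ 1 → w σ = 0) →
        H *ᵥ w = ((H.minEnergyOn (paritySubmodule (Λ := Λ) 1) : ℝ) : ℂ) • w → ∃ c : ℂ, w = c • Po) := by
  -- an odd configuration
  set τ₁ : TensorIndex Λ 2 := flipAt x₀ (fun _ => 0) with hτ₁
  have hτ₁odd : (∑ z, (τ₁ z : ℕ)) % 2 = 1 := by
    have h := weight_flipAt x₀ (fun _ : Λ => (0 : Fin 2))
    simp only [Fin.val_zero, Finset.sum_const_zero, mul_zero, add_zero] at h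
    rw [hτ₁]; omega
  -- the odd block minimum
  set Eo : ℝ := H.minEnergyOn (paritySubmodule (Λ := Λ) 1) with hEo
  obtain ⟨⟨p₀, hp₀supp, hp₀0, hHp₀⟩, hEob⟩ := exists_blockGround H hHh hpar 1 ⟨τ₁, hτ₁odd⟩
  obtain ⟨hpos, huniq⟩ := parityBlock_perronFrobenius_local G hG H hreal hsymm hoff hflip 1 hEob
  obtain ⟨c₁, hc₁, hc₁pos⟩ := hpos p₀ hp₀0 hp₀supp hHp₀
  set Po : TensorIndex Λ 2 → ℂ := c₁ • p₀ with hPo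
  have hPosupp : ∀ σ, (∑ z, (σ z : ℕ)) % 2 ≠ 1 → Po σ = 0 := fun σ hσ => by
    rw [hPo, Pi.smul_apply, smul_eq_mul, hp₀supp σ hσ, mul_zero]
  have hPopos : ∀ σ, (∑ z, (σ z : ℕ)) % 2 = 1 → 0 < (Po σ).re ∧ (Po σ).im = 0 := fun σ hσ => hc₁pos σ hσ
  have hPo0 : Po ≠ 0 := smul_ne_zero hc₁ hp₀0
  have hHPo : H *ᵥ Po = (Eo : ℂ) • Po := by rw [hPo, Matrix.mulVec_smul, hHp₀, smul_comm]
  -- `Y² Po = μ Po`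
  have hYYsupp : ∀ σ, (∑ z, (σ z : ℕ)) % 2 ≠ 1 → (Y *ᵥ (Y *ᵥ Po)) σ = 0 :=
    mulVec_support_of_parityChanging Y hYpar 0 two_pos (mulVec_support_of_parityChanging Y hYpar 1 one_lt_two hPosupp)
  have hcomm : ∀ w : TensorIndex Λ 2 → ℂ, H *ᵥ (Y *ᵥ w) = Y *ᵥ (H *ᵥ w) := fun w => by
    rw [Matrix.mulVec_mulVec, Matrix.mulVec_mulVec, hHY]
  have hHYY : H *ᵥ (Y *ᵥ (Y *ᵥ Po)) = (Eo : ℂ) • (Y *ᵥ (Y *ᵥ Po)) := by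
    rw [hcomm, hcomm, hHPo, Matrix.mulVec_smul, Matrix.mulVec_smul]
  obtain ⟨μ, hμ⟩ := huniq Po (Y *ᵥ (Y *ᵥ Po)) hPosupp hYYsupp hHPo hHYY hPo0
  -- the even Perron vector `Pe = c₀ • P` and `Φ = X Pe`
  obtain ⟨hpos0, -⟩ := parityBlock_perronFrobenius G hG H hreal hsymm hoff hflip hE0 0
  obtain ⟨c₀, hc₀, hc₀pos⟩ := hpos0 P hP0 hPsupp hHP
  set Φ : TensorIndex Λ 2 → ℂ := X *ᵥ (c₀ • P) with hΦ
  have hΦpos : ∀ τ, (∑ z, (τ z : ℕ)) % 2 = 1 → 0 < (Φ τ).re ∧ (Φ τ).im = 0 := by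
    intro τ hτ
    have hterm : ∀ x : Λ, 0 < ((c₀ • P) (flipAt x τ)).re ∧ ((c₀ • P) (flipAt x τ)).im = 0 := by
      intro x
      have hev : (∑ z, (flipAt x τ z : ℕ)) % 2 = 0 := by
        have h1 := weight_flipAt_mod_two x τ; rw [hτ] at h1
        have h2 := Nat.mod_lt (∑ z, (flipAt x τ z : ℕ)) two_pos
        omega
      exact hc₀pos _ hev
    rw [hΦ, hX]
    refine ⟨?_, ?_⟩
    · rw [Complex.div_ofNat_re, Complex.re_sum]
      exact div_pos (Finset.sum_pos (fun x _ => (hterm x).1) ⟨x₀, Finset.mem_univ _⟩) two_pos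
    · rw [Complex.div_ofNat_im, Complex.im_sum, Finset.sum_eq_zero (fun x _ => (hterm x).2), zero_div]
  have hYYΦ : Y *ᵥ (Y *ᵥ Φ) = Φ := by
    rw [hΦ, Matrix.mulVec_smul, Matrix.mulVec_smul, Matrix.mulVec_smul, hYYX]
  -- the pairing `⟨Φ, Po⟩ > 0`
  have hpair : star Φ ⬝ᵥ Po ≠ 0 := by
    intro h
    have hre : (star Φ ⬝ᵥ Po).re = ∑ τ, (star (Φ τ) * Po τ).re := by
      rw [dotProduct, Complex.re_sum]; rfl
    have hnn : ∀ τ ∈ (Finset.univ : Finset (TensorIndex Λ 2)), 0 ≤ (star (Φ τ) * Po τ).re := by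
      intro τ _
      by_cases hτ : (∑ z, (τ z : ℕ)) % 2 = 1
      · obtain ⟨h1, h2⟩ := hΦpos τ hτ
        obtain ⟨h3, h4⟩ := hPopos τ hτ
        rw [Complex.mul_re, Complex.star_def, Complex.conj_re, Complex.conj_im, h2, h4]
        nlinarith
      · rw [hPosupp τ hτ, mul_zero, Complex.zero_re]
    have hposτ : 0 < (star (Φ τ₁) * Po τ₁).re := by
      obtain ⟨h1, h2⟩ := hΦpos τ₁ hτ₁odd
      obtain ⟨h3, h4⟩ := hPopos τ₁ hτ₁odd
      rw [Complex.mul_re, Complex.star_def, Complex.conj_re, Complex.conj_im, h2, h4]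
      nlinarith
    have hsum : 0 < (star Φ ⬝ᵥ Po).re := by
      rw [hre]; exact Finset.sum_pos' hnn ⟨τ₁, Finset.mem_univ _, hposτ⟩
    rw [h, Complex.zero_re] at hsum
    exact lt_irrefl _ hsum
  -- `μ = 1` by Hermiticity of `Y²`
  have hμ1 : μ = 1 := by
    have h1 : star Φ ⬝ᵥ (Y *ᵥ (Y *ᵥ Po)) = μ * (star Φ ⬝ᵥ Po) := by
      rw [hμ, dotProduct_smul, smul_eq_mul]
    have h2 : star Φ ⬝ᵥ (Y *ᵥ (Y *ᵥ Po)) = star Φ ⬝ᵥ Po := by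
      rw [star_dotProduct_mulVec_of_isHermitian hYh, star_dotProduct_mulVec_of_isHermitian hYh, hYYΦ]
    have h3 : (μ - 1) * (star Φ ⬝ᵥ Po) = 0 := by rw [sub_mul, one_mul, ← h1, h2, sub_self]
    exact sub_eq_zero.1 ((mul_eq_zero.1 h3).resolve_right hpair)
  rw [hμ1, one_smul] at hμ
  exact ⟨Po, hPo0, hPosupp, hPopos, hHPo, hμ, hEob, fun w hw hHw => huniq Po w hPosupp hw hHPo hHw hPo0⟩

/-! ### uniqueness of the ground state -/

/-- **Z⁺ uniqueness in the two-block setting: every ground vector of `H` is a multiple of the even-supported ground vector `P`.**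
(An odd ground component would make the odd block attain `E₀`; then `Y P_o`, an even ground vector, is a multiple of `P` and is killed by
`Y`, contradicting `Y²P_o = P_o ≠ 0`.) THEOREM-Z.md (4) / THEOREM-L1.md (E). [folklore] -/
theorem ground_unique_of_twoBlock (hG : G.Connected) (x₀ : Λ) (H Y X : Op Λ 2)
    (hHh : H.IsHermitian)
    (hreal : ∀ σ τ : TensorIndex Λ 2, star (H σ τ) = H σ τ)
    (hsymm : ∀ σ τ : TensorIndex Λ 2, H σ τ = H τ σ)
    (hoff : ∀ σ τ : TensorIndex Λ 2, σ ≠ τ → (H σ τ).re ≤ 0)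
    (hpar : ∀ σ τ : TensorIndex Λ 2, (∑ z, (σ z : ℕ)) % 2 ≠ (∑ z, (τ z : ℕ)) % 2 → H σ τ = 0)
    (hflip : ∀ (x y : Λ) (σ : TensorIndex Λ 2), G.Adj x y → H σ (flipAt x (flipAt y σ)) ≠ 0)
    (hHY : H * Y = Y * H) (hYh : Yᴴ = Y)
    (hYpar : ∀ σ τ : TensorIndex Λ 2, (∑ z, (σ z : ℕ)) % 2 = (∑ z, (τ z : ℕ)) % 2 → Y σ τ = 0)
    (hX : ∀ (v : TensorIndex Λ 2 → ℂ) (τ : TensorIndex Λ 2), (X *ᵥ v) τ = (∑ x, v (flipAt x τ)) / 2)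
    {E₀ : ℝ} (hE0 : ∀ v : TensorIndex Λ 2 → ℂ, E₀ * (star v ⬝ᵥ v).re ≤ (star v ⬝ᵥ H *ᵥ v).re)
    {P : TensorIndex Λ 2 → ℂ} (hP0 : P ≠ 0) (hPsupp : ∀ σ, (∑ z, (σ z : ℕ)) % 2 ≠ 0 → P σ = 0)
    (hHP : H *ᵥ P = (E₀ : ℂ) • P) (hYP : Y *ᵥ P = 0) (hYYX : Y *ᵥ (Y *ᵥ (X *ᵥ P)) = X *ᵥ P)
    {v : TensorIndex Λ 2 → ℂ} (hHv : H *ᵥ v = (E₀ : ℂ) • v) : ∃ c : ℂ, v = c • P := by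
  obtain ⟨Po, hPo0, hPosupp, hPopos, hHPo, hYYPo, hEob, hPouniq⟩ :=
    oddBlock_perron_Ysq G hG x₀ H Y X hHh hreal hsymm hoff hpar hflip hHY hYh hYpar hX hE0 hP0 hPsupp hHP hYYX
  obtain ⟨-, huniq0⟩ := parityBlock_perronFrobenius G hG H hreal hsymm hoff hflip hE0 0
  set Eo : ℝ := H.minEnergyOn (paritySubmodule (Λ := Λ) 1) with hEo
  -- the parity components of `v`
  set ve : TensorIndex Λ 2 → ℂ := fun σ => if (∑ z, (σ z : ℕ)) % 2 = 0 then v σ else 0 with hve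
  set vo : TensorIndex Λ 2 → ℂ := fun σ => if (∑ z, (σ z : ℕ)) % 2 = 1 then v σ else 0 with hvo
  have hHve : H *ᵥ ve = (E₀ : ℂ) • ve := mulVec_parityComponent H hpar hHv 0
  have hHvo : H *ᵥ vo = (E₀ : ℂ) • vo := mulVec_parityComponent H hpar hHv 1
  have hvesupp : ∀ σ, (∑ z, (σ z : ℕ)) % 2 ≠ 0 → ve σ = 0 := fun σ hσ => by rw [hve]; exact if_neg hσ
  have hvosupp : ∀ σ, (∑ z, (σ z : ℕ)) % 2 ≠ 1 → vo σ = 0 := fun σ hσ => by rw [hvo]; exact if_neg hσ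
  -- the odd component vanishes
  have hvo0 : vo = 0 := by
    by_contra hne
    -- the odd block attains `E₀`: `Eo = E₀`
    have hle : Eo ≤ E₀ := by
      have h := hEob vo hvosupp
      rw [hHvo, dotProduct_smul, smul_eq_mul, Complex.re_ofReal_mul] at h
      exact le_of_mul_le_mul_right h (EigenvalueContinuation.re_star_dotProduct_self_pos hne)
    have hge : E₀ ≤ Eo := by
      have h := hE0 Po
      rw [hHPo, dotProduct_smul, smul_eq_mul, Complex.re_ofReal_mul] at h
      exact le_of_mul_le_mul_right h (EigenvalueContinuation.re_star_dotProduct_self_pos hPo0)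
    have hEq : Eo = E₀ := le_antisymm hle hge
    -- `Y Po` is an even ground vector, hence a multiple of `P`, hence killed by `Y`
    have hYPosupp : ∀ σ, (∑ z, (σ z : ℕ)) % 2 ≠ 0 → (Y *ᵥ Po) σ = 0 :=
      mulVec_support_of_parityChanging Y hYpar 1 one_lt_two hPosupp
    have hHYPo : H *ᵥ (Y *ᵥ Po) = (E₀ : ℂ) • (Y *ᵥ Po) := by
      rw [Matrix.mulVec_mulVec, hHY, ← Matrix.mulVec_mulVec, hHPo, hEq, Matrix.mulVec_smul]
    obtain ⟨c, hc⟩ := huniq0 P (Y *ᵥ Po) hPsupp hYPosupp hHP hHYPo hP0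
    have : Y *ᵥ (Y *ᵥ Po) = 0 := by rw [hc, Matrix.mulVec_smul, hYP, smul_zero]
    rw [hYYPo] at this
    exact hPo0 this
  -- so `v = ve` is an even ground vector
  have hvve : v = ve := by
    funext σ
    have h := congrFun hvo0 σ
    simp only [hvo, Pi.zero_apply] at h
    by_cases hσ : (∑ z, (σ z : ℕ)) % 2 = 0
    · rw [hve]; exact (if_pos hσ).symm
    · have hσ1 : (∑ z, (σ z : ℕ)) % 2 = 1 := by have := Nat.mod_lt (∑ z, (σ z : ℕ)) two_pos; omega
      rw [if_pos hσ1] at h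
      rw [h, hve]; exact (if_neg hσ).symm
  by_cases hv0 : v = 0
  · exact ⟨0, by rw [hv0, zero_smul]⟩
  · have hve0 : ve ≠ 0 := by rw [← hvve]; exact hv0
    obtain ⟨c, hc⟩ := huniq0 P ve hPsupp hvesupp hHP hHve hP0
    exact ⟨c, by rw [hvve, hc]⟩

/-! ### energy comparison for an eigenvector with a non-zero `Y`-eigenvalue -/

/-- **Z⁺ (strict) and L1 in the two-block setting.**  An eigenvector `ψ` of `H` at `E` with `Yψ = μψ`, `μ ≠ 0`, both of whose parity
components are non-zero, has `E₀ < E` (its even component would otherwise be `∝ P`, killed by `Y`) and `E_o ≤ E` (variational on the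
odd block), with `E_o < E` unless `μ² = 1` (its odd component would otherwise be `∝ P_o`, a `Y² = 1` vector). [folklore] -/
theorem energy_bounds_of_twoBlock (hG : G.Connected) (x₀ : Λ) (H Y X : Op Λ 2)
    (hHh : H.IsHermitian)
    (hreal : ∀ σ τ : TensorIndex Λ 2, star (H σ τ) = H σ τ)
    (hsymm : ∀ σ τ : TensorIndex Λ 2, H σ τ = H τ σ)
    (hoff : ∀ σ τ : TensorIndex Λ 2, σ ≠ τ → (H σ τ).re ≤ 0)
    (hpar : ∀ σ τ : TensorIndex Λ 2, (∑ z, (σ z : ℕ)) % 2 ≠ (∑ z, (τ z : ℕ)) % 2 → H σ τ = 0)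
    (hflip : ∀ (x y : Λ) (σ : TensorIndex Λ 2), G.Adj x y → H σ (flipAt x (flipAt y σ)) ≠ 0)
    (hHY : H * Y = Y * H) (hYh : Yᴴ = Y)
    (hYpar : ∀ σ τ : TensorIndex Λ 2, (∑ z, (σ z : ℕ)) % 2 = (∑ z, (τ z : ℕ)) % 2 → Y σ τ = 0)
    (hX : ∀ (v : TensorIndex Λ 2 → ℂ) (τ : TensorIndex Λ 2), (X *ᵥ v) τ = (∑ x, v (flipAt x τ)) / 2)
    {E₀ : ℝ} (hE0 : ∀ v : TensorIndex Λ 2 → ℂ, E₀ * (star v ⬝ᵥ v).re ≤ (star v ⬝ᵥ H *ᵥ v).re)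
    {P : TensorIndex Λ 2 → ℂ} (hP0 : P ≠ 0) (hPsupp : ∀ σ, (∑ z, (σ z : ℕ)) % 2 ≠ 0 → P σ = 0)
    (hHP : H *ᵥ P = (E₀ : ℂ) • P) (hYP : Y *ᵥ P = 0) (hYYX : Y *ᵥ (Y *ᵥ (X *ᵥ P)) = X *ᵥ P)
    {ψ : TensorIndex Λ 2 → ℂ} {E : ℝ} {μ : ℂ} (hHψ : H *ᵥ ψ = (E : ℂ) • ψ) (hYψ : Y *ᵥ ψ = μ • ψ) (hμ : μ ≠ 0)
    (hψe : (fun σ => if (∑ z, (σ z : ℕ)) % 2 = 0 then ψ σ else 0) ≠ 0)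
    (hψo : (fun σ => if (∑ z, (σ z : ℕ)) % 2 = 1 then ψ σ else 0) ≠ 0) :
    E₀ < E ∧ H.minEnergyOn (paritySubmodule (Λ := Λ) 1) ≤ E ∧
      (μ ^ 2 ≠ 1 → H.minEnergyOn (paritySubmodule (Λ := Λ) 1) < E) := by
  obtain ⟨Po, hPo0, hPosupp, hPopos, hHPo, hYYPo, hEob, hPouniq⟩ :=
    oddBlock_perron_Ysq G hG x₀ H Y X hHh hreal hsymm hoff hpar hflip hHY hYh hYpar hX hE0 hP0 hPsupp hHP hYYX
  obtain ⟨-, huniq0⟩ := parityBlock_perronFrobenius G hG H hreal hsymm hoff hflip hE0 0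
  set Eo : ℝ := H.minEnergyOn (paritySubmodule (Λ := Λ) 1) with hEo
  set ψe : TensorIndex Λ 2 → ℂ := fun σ => if (∑ z, (σ z : ℕ)) % 2 = 0 then ψ σ else 0 with hψedef
  set ψo : TensorIndex Λ 2 → ℂ := fun σ => if (∑ z, (σ z : ℕ)) % 2 = 1 then ψ σ else 0 with hψodef
  have hHψe : H *ᵥ ψe = (E : ℂ) • ψe := mulVec_parityComponent H hpar hHψ 0
  have hHψo : H *ᵥ ψo = (E : ℂ) • ψo := mulVec_parityComponent H hpar hHψ 1
  have hψesupp : ∀ σ, (∑ z, (σ z : ℕ)) % 2 ≠ 0 → ψe σ = 0 := fun σ hσ => by rw [hψedef]; exact if_neg hσ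
  have hψosupp : ∀ σ, (∑ z, (σ z : ℕ)) % 2 ≠ 1 → ψo σ = 0 := fun σ hσ => by rw [hψodef]; exact if_neg hσ
  -- `Y² ψ = μ² ψ`, and the same for the components
  have hYYψ : (Y * Y) *ᵥ ψ = (μ ^ 2) • ψ := by
    rw [← Matrix.mulVec_mulVec, hYψ, Matrix.mulVec_smul, hYψ, smul_smul, sq]
  have hparYY := mul_self_apply_of_parityChanging Y hYpar
  have hYYψe : (Y * Y) *ᵥ ψe = (μ ^ 2) • ψe := mulVec_parityComponent (Y * Y) hparYY hYYψ 0
  have hYYψo : (Y * Y) *ᵥ ψo = (μ ^ 2) • ψo := mulVec_parityComponent (Y * Y) hparYY hYYψ 1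
  -- `E₀ ≤ E` and `Eo ≤ E`
  have hψ0 : ψ ≠ 0 := by
    intro h; apply hψe; funext σ; rw [hψedef]; simp [h]
  have hle0 : E₀ ≤ E := by
    have h := hE0 ψ
    rw [hHψ, dotProduct_smul, smul_eq_mul, Complex.re_ofReal_mul] at h
    exact le_of_mul_le_mul_right h (EigenvalueContinuation.re_star_dotProduct_self_pos hψ0)
  have hleo : Eo ≤ E := by
    have h := hEob ψo hψosupp
    rw [hHψo, dotProduct_smul, smul_eq_mul, Complex.re_ofReal_mul] at h
    exact le_of_mul_le_mul_right h (EigenvalueContinuation.re_star_dotProduct_self_pos hψo)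
  refine ⟨lt_of_le_of_ne hle0 ?_, hleo, fun hμ2 => lt_of_le_of_ne hleo ?_⟩
  · -- `E ≠ E₀`: otherwise `ψe ∝ P` is killed by `Y`, but `Y²ψe = μ²ψe`
    intro hE
    rw [← hE] at hHψe
    obtain ⟨c, hc⟩ := huniq0 P ψe hPsupp hψesupp hHP hHψe hP0
    have h1 : (Y * Y) *ᵥ ψe = 0 := by
      rw [hc, Matrix.mulVec_smul, ← Matrix.mulVec_mulVec, hYP, Matrix.mulVec_zero, smul_zero]
    rw [hYYψe] at h1
    rcases smul_eq_zero.1 h1 with h | h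
    · exact hμ (pow_eq_zero_iff (two_ne_zero) |>.1 h)
    · exact hψe h
  · -- `E ≠ Eo` when `μ² ≠ 1`: otherwise `ψo ∝ Po` is a `Y² = 1` vector
    intro hE
    rw [← hE] at hHψo
    obtain ⟨c, hc⟩ := hPouniq ψo hψosupp hHψo
    have h1 : (Y * Y) *ᵥ ψo = ψo := by
      rw [hc, Matrix.mulVec_smul, ← Matrix.mulVec_mulVec, hYYPo]
    rw [hYYψo] at h1
    have h2 : (μ ^ 2 - 1) • ψo = 0 := by rw [sub_smul, one_smul, h1, sub_self]
    rcases smul_eq_zero.1 h2 with h | h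
    · exact hμ2 (sub_eq_zero.1 h)
    · exact hψo h

/-! ### the odd-block minimum is attained by a `Y = ±1` eigenvector -/

/-- **The odd-block minimum `E_o` is attained by an eigenvector of `Y` with eigenvalue `+1` or `−1`** (`P_o ± Y P_o`, one of which is
non-zero, since `Y²P_o = P_o`). THEOREM-L1.md (F). [folklore] -/
theorem exists_oddGround_Y_eq (hG : G.Connected) (x₀ : Λ) (H Y X : Op Λ 2)
    (hHh : H.IsHermitian)
    (hreal : ∀ σ τ : TensorIndex Λ 2, star (H σ τ) = H σ τ)
    (hsymm : ∀ σ τ : TensorIndex Λ 2, H σ τ = H τ σ)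
    (hoff : ∀ σ τ : TensorIndex Λ 2, σ ≠ τ → (H σ τ).re ≤ 0)
    (hpar : ∀ σ τ : TensorIndex Λ 2, (∑ z, (σ z : ℕ)) % 2 ≠ (∑ z, (τ z : ℕ)) % 2 → H σ τ = 0)
    (hflip : ∀ (x y : Λ) (σ : TensorIndex Λ 2), G.Adj x y → H σ (flipAt x (flipAt y σ)) ≠ 0)
    (hHY : H * Y = Y * H) (hYh : Yᴴ = Y)
    (hYpar : ∀ σ τ : TensorIndex Λ 2, (∑ z, (σ z : ℕ)) % 2 = (∑ z, (τ z : ℕ)) % 2 → Y σ τ = 0)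
    (hX : ∀ (v : TensorIndex Λ 2 → ℂ) (τ : TensorIndex Λ 2), (X *ᵥ v) τ = (∑ x, v (flipAt x τ)) / 2)
    {E₀ : ℝ} (hE0 : ∀ v : TensorIndex Λ 2 → ℂ, E₀ * (star v ⬝ᵥ v).re ≤ (star v ⬝ᵥ H *ᵥ v).re)
    {P : TensorIndex Λ 2 → ℂ} (hP0 : P ≠ 0) (hPsupp : ∀ σ, (∑ z, (σ z : ℕ)) % 2 ≠ 0 → P σ = 0)
    (hHP : H *ᵥ P = (E₀ : ℂ) • P) (hYYX : Y *ᵥ (Y *ᵥ (X *ᵥ P)) = X *ᵥ P) :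
    ∃ p : TensorIndex Λ 2 → ℂ, p ≠ 0 ∧ H *ᵥ p = ((H.minEnergyOn (paritySubmodule (Λ := Λ) 1) : ℝ) : ℂ) • p ∧
      (Y *ᵥ p = p ∨ Y *ᵥ p = -p) := by
  obtain ⟨Po, hPo0, hPosupp, hPopos, hHPo, hYYPo, hEob, hPouniq⟩ :=
    oddBlock_perron_Ysq G hG x₀ H Y X hHh hreal hsymm hoff hpar hflip hHY hYh hYpar hX hE0 hP0 hPsupp hHP hYYX
  set Eo : ℝ := H.minEnergyOn (paritySubmodule (Λ := Λ) 1) with hEo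
  have hHY' : H *ᵥ (Y *ᵥ Po) = (Eo : ℂ) • (Y *ᵥ Po) := by
    rw [Matrix.mulVec_mulVec, hHY, ← Matrix.mulVec_mulVec, hHPo, Matrix.mulVec_smul]
  by_cases hplus : Po + Y *ᵥ Po = 0
  · -- then `Y Po = −Po`
    exact ⟨Po, hPo0, hHPo, Or.inr (eq_neg_of_add_eq_zero_right hplus)⟩
  · refine ⟨Po + Y *ᵥ Po, hplus, ?_, Or.inl ?_⟩
    · rw [Matrix.mulVec_add, hHPo, hHY', smul_add]
    · rw [Matrix.mulVec_add, hYYPo, add_comm]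

end TwoBlock

end Summit.HubbardSuperconductivity.HubbardSuperconductivity.Theorems.AnisotropyChord.Transfer
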